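import Summits.Ventures.DiscreteObjects.Hadamard.ElemAbelianRank2_7

/-!
# Hadamard 668 census, family F12 — `C₅ × C₅` and `C₃ × C₃`: the kernel part of the structure (regular-orbit bound)

Framing: lottery ticket; floor = certified bounds/negative ranges.

Cell pub-namedobj (venture DiscreteObjects), target (H), hadamard gen 17.  `C₅ × C₅` and `C₃ × C₃` are NOT excluded as
groups of signed automorphisms of an H(668) by the inequalities of gens 16/17 (at the summed orbit level 102 resp. 34,735
structure pairs survive the exact identities; (+) control `C₃ × C₃ ≤ Aut H(12)`).  This file records what the kernel
tools DO give, as certified starting points for a successor: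
* `census5`, `census3`: an order-5 (order-3) signed automorphism of an H(668) fixes `f` columns and `f` rows with
  `8 ≤ f ≤ 108`, `f ≡ 8 (mod 10)` (`2 ≤ f ≤ 164`, `f ≡ 2 (mod 6)`) — the windows of `HadamardOrbitCounts668`;
* **`rank2_5_fixedAll`**, **`rank2_3_fixedAll`**: for two signed automorphisms generating `C_p × C_p` on the rows
  (`p = 5, 3`), the set `D'` of columns fixed by both satisfies `p²·|D'| ≤ 668` and `|D'| ≡ 668 (mod p)`, i.e.
  `|D'| ∈ {3, 8, 13, 18, 23}` for `p = 5` and `|D'| ∈ {2, 5, …, 74}` for `p = 3`: a row with trivial stabiliser exists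
  because the `p + 1` line representatives fix at most `6·108 = 648 < 668` resp. `4·164 = 656 < 668` rows
  (`rank2_exists_free`), and `rank2_regular_bound` applies.  (Gen 16's exact survivors for `p = 5` all have
  `|D| = |D'| ∈ {8, 18}` — not claimed here.)
Ours, not literature; no `sorry`; default heartbeats.
-/

namespace Summit.Ventures.DiscreteObjects.Hadamard

open Finset BigOperators Matrix

open Literature.Combinatorics.Designs.GoethalsSeidel (IsHadamardMatrix)

variable {ι : Type*} [Fintype ι] [DecidableEq ι]

/-- the window for order 5 at the matrix level: `8 ≤ f ≤ 108`, `f ≡ 8 (mod 10)` fixed columns, and the same for rows -/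
lemma census5 {H : Matrix ι ι ℤ} (hH : IsHadamardMatrix H) (hι : Fintype.card ι = 668)
    {π κ : Equiv.Perm ι} {d e : ι → ℤ} (haut : IsSignedAut H π κ d e) (hπ : π ^ 5 = 1) (hκ : κ ^ 5 = 1)
    (hne : π ≠ 1) :
    (8 ≤ (univ.filter fun j => κ j = j).card ∧ (univ.filter fun j => κ j = j).card ≤ 108 ∧
      (univ.filter fun j => κ j = j).card % 10 = 8) ∧
    (8 ≤ (univ.filter fun i => π i = i).card ∧ (univ.filter fun i => π i = i).card ≤ 108 ∧
      (univ.filter fun i => π i = i).card % 10 = 8) := by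
  have hp : (5 : ℕ).Prime := by norm_num
  have hmem : (5 : ℕ) = 3 ∨ (5 : ℕ) = 5 ∨ (5 : ℕ) = 7 ∨ (5 : ℕ) = 11 := Or.inr (Or.inl rfl)
  obtain ⟨⟨a, ha⟩, -, wc, -, -⟩ := hadamard668_signedAut_colClasses_window hH hι hmem π κ d e haut hπ hκ (Or.inl hne)
  obtain ⟨⟨b, hb⟩, -, wr, -, -⟩ := hadamard668_signedAut_rowClasses_window hH hι hmem π κ d e haut hπ hκ (Or.inl hne)
  have hc1 := card_fixed_add_classes κ hp hκ; have hr1 := card_fixed_add_classes π hp hπ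
  rw [hι] at hc1 hr1
  have wc' := wc rfl; have wr' := wr rfl
  constructor <;> omega

/-- the window for order 3 at the matrix level: `2 ≤ f ≤ 164`, `f ≡ 2 (mod 6)` fixed columns, and the same for rows -/
lemma census3 {H : Matrix ι ι ℤ} (hH : IsHadamardMatrix H) (hι : Fintype.card ι = 668)
    {π κ : Equiv.Perm ι} {d e : ι → ℤ} (haut : IsSignedAut H π κ d e) (hπ : π ^ 3 = 1) (hκ : κ ^ 3 = 1)
    (hne : π ≠ 1) :
    (2 ≤ (univ.filter fun j => κ j = j).card ∧ (univ.filter fun j => κ j = j).card ≤ 164 ∧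
      (univ.filter fun j => κ j = j).card % 6 = 2) ∧
    (2 ≤ (univ.filter fun i => π i = i).card ∧ (univ.filter fun i => π i = i).card ≤ 164 ∧
      (univ.filter fun i => π i = i).card % 6 = 2) := by
  have hp : (3 : ℕ).Prime := by norm_num
  have hmem : (3 : ℕ) = 3 ∨ (3 : ℕ) = 5 ∨ (3 : ℕ) = 7 ∨ (3 : ℕ) = 11 := Or.inl rfl
  obtain ⟨⟨a, ha⟩, wc, -, -, -⟩ := hadamard668_signedAut_colClasses_window hH hι hmem π κ d e haut hπ hκ (Or.inl hne)
  obtain ⟨⟨b, hb⟩, wr, -, -, -⟩ := hadamard668_signedAut_rowClasses_window hH hι hmem π κ d e haut hπ hκ (Or.inl hne)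
  have hc1 := card_fixed_add_classes κ hp hκ; have hr1 := card_fixed_add_classes π hp hπ
  rw [hι] at hc1 hr1
  have wc' := wc rfl; have wr' := wr rfl
  constructor <;> omega

section small
variable {H : Matrix ι ι ℤ} {α α' β β' : Equiv.Perm ι} {d₁ e₁ d₂ e₂ : ι → ℤ}

/-- **C_5 × C_5: the columns fixed by everything** — `5²·|D'| ≤ 668` and `|D'| ≡ 3 (mod 5)`, given that the
ROW parts of all `g ≠ 1` are nontrivial (for the rows fixed by everything apply this to `Hᵀ`). -/
lemma rank2_5_fixedAll (hH : IsHadamardMatrix H) (hι : Fintype.card ι = 668)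
    (hA : IsSignedAut H α α' d₁ e₁) (hB : IsSignedAut H β β' d₂ e₂)
    (hα : α ^ 5 = 1) (hα' : α' ^ 5 = 1) (hβ : β ^ 5 = 1) (hβ' : β' ^ 5 = 1)
    (hc : Commute α β) (hc' : Commute α' β')
    (hne : ∀ g : Multiplicative (ZMod 5 × ZMod 5), g ≠ 1 → (α ^ (Multiplicative.toAdd g).1.val * β ^ (Multiplicative.toAdd g).2.val) ≠ 1) :
    5 ^ 2 * (univ.filter fun y => α' y = y ∧ β' y = y).card ≤ 668 ∧
      (univ.filter fun y => α' y = y ∧ β' y = y).card % 5 = 3 := by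
  haveI hpf : Fact (Nat.Prime 5) := ⟨by norm_num⟩
  have hodd : Odd 5 := ⟨2, by norm_num⟩
  have hcensus : ∀ g : Multiplicative (ZMod 5 × ZMod 5), g ≠ 1 →
      (8 ≤ (univ.filter fun j => (α' ^ (Multiplicative.toAdd g).1.val * β' ^ (Multiplicative.toAdd g).2.val) j = j).card ∧
        (univ.filter fun j => (α' ^ (Multiplicative.toAdd g).1.val * β' ^ (Multiplicative.toAdd g).2.val) j = j).card ≤ 108 ∧
        (univ.filter fun j => (α' ^ (Multiplicative.toAdd g).1.val * β' ^ (Multiplicative.toAdd g).2.val) j = j).card % 10 = 8) ∧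
      (8 ≤ (univ.filter fun i => (α ^ (Multiplicative.toAdd g).1.val * β ^ (Multiplicative.toAdd g).2.val) i = i).card ∧
        (univ.filter fun i => (α ^ (Multiplicative.toAdd g).1.val * β ^ (Multiplicative.toAdd g).2.val) i = i).card ≤ 108 ∧
        (univ.filter fun i => (α ^ (Multiplicative.toAdd g).1.val * β ^ (Multiplicative.toAdd g).2.val) i = i).card % 10 = 8) := by
    intro g hg
    obtain ⟨d, e, hg'⟩ := isSignedAut_pair 5 hA hB g
    exact census5 hH hι hg' (pairPerm_pow_p 5 α β hα hβ hc g) (pairPerm_pow_p 5 α' β' hα' hβ' hc' g) (hne g hg)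
  have hN : ∀ r ∈ (insert (Multiplicative.ofAdd ((0 : ZMod 5), (1 : ZMod 5)))
        ((univ : Finset (ZMod 5)).image (fun t => Multiplicative.ofAdd ((1 : ZMod 5), t)))),
      (univ.filter fun x => (α ^ (Multiplicative.toAdd r).1.val * β ^ (Multiplicative.toAdd r).2.val) x = x).card ≤ 108 := by
    intro r hr
    exact ((hcensus r (lineRep_ne_one 5 hr)).2).2.1
  obtain ⟨x₁, hx₁⟩ := rank2_exists_free 5 α β hα hβ hc 108 hN (by rw [hι]; norm_num)
  have hsq := rank2_regular_bound 5 hH hodd hA hB hα hα' hβ hβ' hc x₁ hx₁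
  rw [hι] at hsq
  refine ⟨hsq, ?_⟩
  obtain ⟨hg1R, -, -, hg1, -, -⟩ := gens_reps 5
  obtain ⟨-, hm⟩ := rank2_card_fixed_mod_gen 5 α' β' hα' hβ' hc' hg1R
  have hcen := ((hcensus _ hg1).1).2.2
  rw [pairPerm_genA] at hcen
  rw [pairPerm_genA] at hm
  omega

/-- **C_3 × C_3: the columns fixed by everything** — `3²·|D'| ≤ 668` and `|D'| ≡ 2 (mod 3)`, given that the
ROW parts of all `g ≠ 1` are nontrivial (for the rows fixed by everything apply this to `Hᵀ`). -/
lemma rank2_3_fixedAll (hH : IsHadamardMatrix H) (hι : Fintype.card ι = 668)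
    (hA : IsSignedAut H α α' d₁ e₁) (hB : IsSignedAut H β β' d₂ e₂)
    (hα : α ^ 3 = 1) (hα' : α' ^ 3 = 1) (hβ : β ^ 3 = 1) (hβ' : β' ^ 3 = 1)
    (hc : Commute α β) (hc' : Commute α' β')
    (hne : ∀ g : Multiplicative (ZMod 3 × ZMod 3), g ≠ 1 → (α ^ (Multiplicative.toAdd g).1.val * β ^ (Multiplicative.toAdd g).2.val) ≠ 1) :
    3 ^ 2 * (univ.filter fun y => α' y = y ∧ β' y = y).card ≤ 668 ∧
      (univ.filter fun y => α' y = y ∧ β' y = y).card % 3 = 2 := by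
  haveI hpf : Fact (Nat.Prime 3) := ⟨by norm_num⟩
  have hodd : Odd 3 := ⟨1, by norm_num⟩
  have hcensus : ∀ g : Multiplicative (ZMod 3 × ZMod 3), g ≠ 1 →
      (2 ≤ (univ.filter fun j => (α' ^ (Multiplicative.toAdd g).1.val * β' ^ (Multiplicative.toAdd g).2.val) j = j).card ∧
        (univ.filter fun j => (α' ^ (Multiplicative.toAdd g).1.val * β' ^ (Multiplicative.toAdd g).2.val) j = j).card ≤ 164 ∧
        (univ.filter fun j => (α' ^ (Multiplicative.toAdd g).1.val * β' ^ (Multiplicative.toAdd g).2.val) j = j).card % 6 = 2) ∧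
      (2 ≤ (univ.filter fun i => (α ^ (Multiplicative.toAdd g).1.val * β ^ (Multiplicative.toAdd g).2.val) i = i).card ∧
        (univ.filter fun i => (α ^ (Multiplicative.toAdd g).1.val * β ^ (Multiplicative.toAdd g).2.val) i = i).card ≤ 164 ∧
        (univ.filter fun i => (α ^ (Multiplicative.toAdd g).1.val * β ^ (Multiplicative.toAdd g).2.val) i = i).card % 6 = 2) := by
    intro g hg
    obtain ⟨d, e, hg'⟩ := isSignedAut_pair 3 hA hB g
    exact census3 hH hι hg' (pairPerm_pow_p 3 α β hα hβ hc g) (pairPerm_pow_p 3 α' β' hα' hβ' hc' g) (hne g hg)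
  have hN : ∀ r ∈ (insert (Multiplicative.ofAdd ((0 : ZMod 3), (1 : ZMod 3)))
        ((univ : Finset (ZMod 3)).image (fun t => Multiplicative.ofAdd ((1 : ZMod 3), t)))),
      (univ.filter fun x => (α ^ (Multiplicative.toAdd r).1.val * β ^ (Multiplicative.toAdd r).2.val) x = x).card ≤ 164 := by
    intro r hr
    exact ((hcensus r (lineRep_ne_one 3 hr)).2).2.1
  obtain ⟨x₁, hx₁⟩ := rank2_exists_free 3 α β hα hβ hc 164 hN (by rw [hι]; norm_num)
  have hsq := rank2_regular_bound 3 hH hodd hA hB hα hα' hβ hβ' hc x₁ hx₁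
  rw [hι] at hsq
  refine ⟨hsq, ?_⟩
  obtain ⟨hg1R, -, -, hg1, -, -⟩ := gens_reps 3
  obtain ⟨-, hm⟩ := rank2_card_fixed_mod_gen 3 α' β' hα' hβ' hc' hg1R
  have hcen := ((hcensus _ hg1).1).2.2
  rw [pairPerm_genA] at hcen
  rw [pairPerm_genA] at hm
  omega

end small

end Summit.Ventures.DiscreteObjects.Hadamard
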